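import Summits.AtomisticToContinuum.BoseEinsteinCondensation.Theorems.BECInsertionCorrectorCorrectorClosureZeroModeFSumAverage
import HarnessLib

/-!
# The zero-mode f-sum bound, II: the zero-mode counting amplitudes `Pⱼ|Φ|` and the commutator
# calculus `[T, N̂₀] = 0`, `[Pⱼ, v_{kl}] = 0 (j ∉ {k,l})` in weak form
# (line `volume-homotopy-sum-rule-domination`, helpers for the registered stub `stub_zeroModeFSum`,
# crux `BECInsertionCorrector.CorrectorClosure`, item stmt-AtomisticToContinuum-12058)

Supports (does not close) stmt-AtomisticToContinuum-12058. Setting: a Bose-symmetric periodic test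
function `F` on `(ℝ³)^{n+2}` (in the application `F = |Φ|` for a real positive minimiser `Φ`), its
slot averages `uⱼ = PⱼF`, `uⱼ(X) = L⁻³ ∫_{[0,L)³} F(X; xⱼ ↦ y) dy` (so that `N̂₀F = ∑ⱼ uⱼ =: u` is the
zero-mode COUNTING AMPLITUDE, `⟨F, N̂₀F⟩ = n₀`), the bath form `G = P₀F` of `u₀ = G∘tail`, and cell
averages `B = P₀b` of further functions `b`; everything is stated with these objects as hypotheses
(`huu`, `hG`, `hB`; no new definitions). Contents:

* relabelling: `uⱼ(X∘σ) = u_{σj}(X)` (`zf_uu_comp_perm`, Bose symmetry of `F`), `u(X∘σ) = u(X)`,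
  every `uⱼ` and `u` is a periodic test function (`zf_isPeriodicTest_uu`, `zf_isPeriodicTest_u`);
* the slot-`0` average in `update` form, `L⁻³∫ b(X; x₀ ↦ y)dy = (P₀b)(tail X)` (`zf_P_eq_avg_tail`), its
  behaviour under relabelling (`zf_avg_tail_comp_perm_of_fix`: invariant under permutations fixing
  `0` for symmetric `b`; `zf_avgUU_tail_comp_swap`: `(P₀u_m)(X∘(0 m)) = (P₀u_m)(X)`, i.e.
  `P_m P₀ F = P₀ P_m F`, two cell integrals commute);
* the three weak commutator identities of `P₀` against the `(n+2)`-body quadratic forms, for a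
  test function `b` with average `B = P₀b`:
  KINETIC `∫ ∇u₀·∇b = ∫ ∇F·∇(B∘tail)` (`zf_kinetic_uu_zero`, `[T, P₀] = 0`),
  MASS `∫ u₀ b = ∫ F (B∘tail)` (`zf_mass_uu_zero`, `P₀ = P₀*`),
  POTENTIAL `∫ h(tail) u₀ b = ∫ h(tail) F (B∘tail)` for every bath weight `h` (`zf_pot_uu_zero`,
  `[P₀, h∘tail] = 0` — the pair potentials `v^per(x_k − x_l)` with `k, l ≥ 1`);
* the two positivity inputs of the f-sum bound: `∫ u₀² ≤ ∫ F²` (`zf_integral_uu_zero_sq_le`) and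
  `∫ v^per(x₀ − x₁)(B∘tail)² = ‖v‖₁ L⁻³ ∫ (B∘tail)²` (`zf_integral_pot_tail_sq`,
  `P₀ v_{01} P₀ = L⁻³‖v‖₁ P₀`).

References: [Stringari1995] §2.3 (19)–(23); [PitaevskiiStringari1991] (9).
-/

noncomputable section

namespace Summit.AtomisticToContinuum.BoseEinsteinCondensation.Theorems.CorrectorClosure.VolumeHomotopySumRuleDomination

open MeasureTheory Filter Matrix
open scoped ENNReal NNReal BigOperators
open Literature.MathematicalPhysics.QuantumManyBody.BoseGas
open Summit.AtomisticToContinuum.BoseEinsteinCondensation.Theorems.CorrectorClosure.GeometricMeanCorrector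
  (tilt_gradDot_comp_perm₂ tilt_contDiff_comp_tail mixedLaw_tail_vecCons mixedLaw_continuous_tail)
open Summit.AtomisticToContinuum.BoseEinsteinCondensation.Theorems.CorrectorClosure.HealingScaleKacInsertion.ResponseDictionary
  (setIntegral_cellN_comp_perm contDiff_comp_perm_real)
open Summit.AtomisticToContinuum.BoseEinsteinCondensation.Theorems.CorrectorClosure.ZeroModeRemovalSusceptibility
  (reb_isLatticePeriodic_tail)
open Summit.AtomisticToContinuum.BoseEinsteinCondensation.Theorems.PositiveMinimiser
  (periodizedPotential_ne_top)

variable {n : ℕ} {L : ℝ}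

/-! ### The slot averages `uⱼ = PⱼF` under relabelling -/

/-- **Bose symmetry moves the averaged slot**: `u_m(X ∘ σ) = u_{σ m}(X)`. [folklore] -/
theorem zf_uu_comp_perm {F : Config (n + 2) → ℝ}
    (hFsymm : ∀ (σ : Equiv.Perm (Fin (n + 2))) (X : Config (n + 2)), F (X ∘ σ) = F X)
    {uu : Fin (n + 2) → Config (n + 2) → ℝ}
    (huu : ∀ m X, uu m X = (L ^ 3)⁻¹ * ∫ y in cell L, F (Function.update X m y))
    (σ : Equiv.Perm (Fin (n + 2))) (m : Fin (n + 2)) (X : Config (n + 2)) :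
    uu m (X ∘ σ) = uu (σ m) X := by
  rw [huu, huu]
  congr 1
  refine integral_congr_ae (ae_of_all _ fun y => ?_)
  have h : Function.update (X ∘ σ) m y = Function.update X (σ m) y ∘ σ := by
    rw [Function.update_comp_equiv X σ (σ m) y, Equiv.symm_apply_apply]
  dsimp only
  rw [h, hFsymm]

/-- `u_m = u₀ ∘ (· ∘ (0 m))`. [folklore] -/
theorem zf_uu_eq_comp_swap {F : Config (n + 2) → ℝ}
    (hFsymm : ∀ (σ : Equiv.Perm (Fin (n + 2))) (X : Config (n + 2)), F (X ∘ σ) = F X)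
    {uu : Fin (n + 2) → Config (n + 2) → ℝ}
    (huu : ∀ m X, uu m X = (L ^ 3)⁻¹ * ∫ y in cell L, F (Function.update X m y))
    (m : Fin (n + 2)) (X : Config (n + 2)) :
    uu m X = uu 0 (X ∘ Equiv.swap 0 m) := by
  rw [zf_uu_comp_perm hFsymm huu, Equiv.swap_apply_left]

/-- **`u₀ = G ∘ tail`** with `G = P₀F` the bath form of the slot-`0` average. [folklore] -/
theorem zf_uu_zero_eq {F : Config (n + 2) → ℝ} {uu : Fin (n + 2) → Config (n + 2) → ℝ}
    (huu : ∀ m X, uu m X = (L ^ 3)⁻¹ * ∫ y in cell L, F (Function.update X m y))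
    {G : Config (n + 1) → ℝ} (hG : ∀ Y, G Y = (L ^ 3)⁻¹ * ∫ x in cell L, F (vecCons x Y))
    (X : Config (n + 2)) : uu 0 X = G (Fin.tail X) := by
  rw [huu, hG]
  simp only [zf_update_zero]

/-- The counting amplitude `u = ∑ⱼ uⱼ` is Bose symmetric. [folklore] -/
theorem zf_u_comp_perm {F : Config (n + 2) → ℝ}
    (hFsymm : ∀ (σ : Equiv.Perm (Fin (n + 2))) (X : Config (n + 2)), F (X ∘ σ) = F X)
    {uu : Fin (n + 2) → Config (n + 2) → ℝ}
    (huu : ∀ m X, uu m X = (L ^ 3)⁻¹ * ∫ y in cell L, F (Function.update X m y))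
    {u : Config (n + 2) → ℝ} (hu : ∀ X, u X = ∑ m, uu m X) (σ : Equiv.Perm (Fin (n + 2)))
    (X : Config (n + 2)) : u (X ∘ σ) = u X := by
  rw [hu, hu]
  simp only [zf_uu_comp_perm hFsymm huu]
  exact Equiv.sum_comp σ (fun m => uu m X)

/-! ### Regularity: `G`, `uⱼ`, `u` are periodic test functions -/

/-- `G = P₀F` is a periodic test function on the bath. [folklore] -/
theorem zf_isPeriodicTest_G (hL : 0 < L) {F : Config (n + 2) → ℝ} (hFt : IsPeriodicTest L F)
    {G : Config (n + 1) → ℝ} (hG : ∀ Y, G Y = (L ^ 3)⁻¹ * ∫ x in cell L, F (vecCons x Y)) :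
    IsPeriodicTest L G :=
  zf_avg_isPeriodicTest hL hFt hG

/-- Every slot average `uⱼ = PⱼF` is a periodic test function on `(ℝ³)^{n+2}`. [folklore] -/
theorem zf_isPeriodicTest_uu (hL : 0 < L) {F : Config (n + 2) → ℝ} (hFt : IsPeriodicTest L F)
    (hFsymm : ∀ (σ : Equiv.Perm (Fin (n + 2))) (X : Config (n + 2)), F (X ∘ σ) = F X)
    {uu : Fin (n + 2) → Config (n + 2) → ℝ}
    (huu : ∀ m X, uu m X = (L ^ 3)⁻¹ * ∫ y in cell L, F (Function.update X m y))
    (m : Fin (n + 2)) : IsPeriodicTest L (uu m) := by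
  obtain ⟨G, hG⟩ : ∃ G : Config (n + 1) → ℝ, G = fun Y => (L ^ 3)⁻¹ * ∫ x in cell L, F (vecCons x Y) :=
    ⟨_, rfl⟩
  have hG' : ∀ Y, G Y = (L ^ 3)⁻¹ * ∫ x in cell L, F (vecCons x Y) := fun Y => by rw [hG]
  have hGt : IsPeriodicTest L G := zf_isPeriodicTest_G hL hFt hG'
  -- `u₀ = G ∘ tail`
  have h0 : uu 0 = fun X => G (Fin.tail X) := funext fun X => zf_uu_zero_eq huu hG' X
  have h0t : IsPeriodicTest L (uu 0) := by
    rw [h0]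
    exact ⟨tilt_contDiff_comp_tail hGt.1, reb_isLatticePeriodic_tail hGt.2⟩
  -- `u_m = u₀ ∘ (· ∘ (0 m))`
  have hm : uu m = fun X => uu 0 (X ∘ Equiv.swap 0 m) := funext fun X => zf_uu_eq_comp_swap hFsymm huu m X
  rw [hm]
  refine ⟨contDiff_comp_perm_real h0t.1 _, fun X i k => ?_⟩
  have h : (X + Pi.single i (EuclideanSpace.single k L)) ∘ Equiv.swap 0 m =
      X ∘ Equiv.swap 0 m + Pi.single ((Equiv.swap 0 m).symm i) (EuclideanSpace.single k L) := by
    rw [← single_comp_perm (Equiv.swap 0 m) i]; rfl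
  simp only [h, h0t.2]

/-- The counting amplitude `u = N̂₀F = ∑ⱼ PⱼF` is a periodic test function. [folklore] -/
theorem zf_isPeriodicTest_u (hL : 0 < L) {F : Config (n + 2) → ℝ} (hFt : IsPeriodicTest L F)
    (hFsymm : ∀ (σ : Equiv.Perm (Fin (n + 2))) (X : Config (n + 2)), F (X ∘ σ) = F X)
    {uu : Fin (n + 2) → Config (n + 2) → ℝ}
    (huu : ∀ m X, uu m X = (L ^ 3)⁻¹ * ∫ y in cell L, F (Function.update X m y))
    {u : Config (n + 2) → ℝ} (hu : ∀ X, u X = ∑ m, uu m X) : IsPeriodicTest L u := by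
  have h : u = fun X => ∑ m, uu m X := funext hu
  rw [h]
  refine ⟨ContDiff.sum fun m _ => (zf_isPeriodicTest_uu hL hFt hFsymm huu m).1, fun X i k => ?_⟩
  exact Finset.sum_congr rfl fun m _ => (zf_isPeriodicTest_uu hL hFt hFsymm huu m).2 X i k

/-! ### The slot-`0` average in `update` form and its relabellings -/

/-- `L⁻³ ∫ b(X; x₀ ↦ y) dy = (P₀b)(tail X)`. [folklore] -/
theorem zf_P_eq_avg_tail {K : ℕ} {b : Config (K + 1) → ℝ} {B : Config K → ℝ}
    (hB : ∀ Y, B Y = (L ^ 3)⁻¹ * ∫ x in cell L, b (vecCons x Y)) (X : Config (K + 1)) :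
    (L ^ 3)⁻¹ * ∫ y in cell L, b (Function.update X 0 y) = B (Fin.tail X) := by
  rw [hB]
  simp only [zf_update_zero]

/-- Relabelling inside the slot-`0` average: `∫ b((X∘σ); x₀ ↦ y) dy = ∫ b((X; x_{σ0} ↦ y) ∘ σ) dy`.
[folklore] -/
theorem zf_P_comp_perm {K : ℕ} (b : Config K → ℝ) (σ : Equiv.Perm (Fin K)) (X : Config K)
    (j : Fin K) :
    ∫ y in cell L, b (Function.update (X ∘ σ) j y) =
      ∫ y in cell L, b (Function.update X (σ j) y ∘ σ) := by
  refine integral_congr_ae (ae_of_all _ fun y => ?_)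
  dsimp only
  rw [Function.update_comp_equiv X σ (σ j) y, Equiv.symm_apply_apply]

/-- **`P₀` of a symmetric function is invariant under relabellings fixing `0`**:
`(P₀b)(tail (X ∘ τ)) = (P₀b)(tail X)` if `τ 0 = 0` and `b` is Bose symmetric. [folklore] -/
theorem zf_avg_tail_comp_perm_of_fix {K : ℕ} {b : Config (K + 1) → ℝ}
    (hbsymm : ∀ (σ : Equiv.Perm (Fin (K + 1))) (X : Config (K + 1)), b (X ∘ σ) = b X)
    {B : Config K → ℝ} (hB : ∀ Y, B Y = (L ^ 3)⁻¹ * ∫ x in cell L, b (vecCons x Y))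
    {τ : Equiv.Perm (Fin (K + 1))} (hτ : τ 0 = 0) (X : Config (K + 1)) :
    B (Fin.tail (X ∘ τ)) = B (Fin.tail X) := by
  rw [← zf_P_eq_avg_tail hB, ← zf_P_eq_avg_tail hB, zf_P_comp_perm b τ X 0, hτ]
  simp only [hbsymm]

/-- A periodic test function is bounded. [folklore] -/
theorem zf_exists_bound (hL : 0 < L) {K : ℕ} {b : Config K → ℝ} (hb : IsPeriodicTest L b) :
    ∃ C : ℝ, ∀ X, |b X| ≤ C := by
  obtain ⟨C, -, hC⟩ := exists_bound_of_continuous_periodic hL hb.continuous hb.2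
  exact ⟨C, hC⟩

/-- **Two slot averages commute**: `(P₀u_m)(tail (X ∘ (0 m))) = (P₀u_m)(tail X)`, i.e.
`P_m P₀ F = P₀ P_m F` read through Bose symmetry (`u_m((X; x_m ↦ y)∘(0 m)) = u₀(X; x_m ↦ y)`,
`update`s in different slots commute, and so do the two cell integrals). [folklore] -/
theorem zf_avgUU_tail_comp_swap (hL : 0 < L) {F : Config (n + 2) → ℝ} (hFt : IsPeriodicTest L F)
    (hFsymm : ∀ (σ : Equiv.Perm (Fin (n + 2))) (X : Config (n + 2)), F (X ∘ σ) = F X)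
    {uu : Fin (n + 2) → Config (n + 2) → ℝ}
    (huu : ∀ m X, uu m X = (L ^ 3)⁻¹ * ∫ y in cell L, F (Function.update X m y))
    {m : Fin (n + 2)} (hm : m ≠ 0) {WW : Config (n + 1) → ℝ}
    (hWW : ∀ Y, WW Y = (L ^ 3)⁻¹ * ∫ x in cell L, uu m (vecCons x Y)) (X : Config (n + 2)) :
    WW (Fin.tail (X ∘ Equiv.swap 0 m)) = WW (Fin.tail X) := by
  obtain ⟨C, hC⟩ := zf_exists_bound hL hFt
  rw [← zf_P_eq_avg_tail hWW, ← zf_P_eq_avg_tail hWW, zf_P_comp_perm (uu m) _ X 0,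
    Equiv.swap_apply_left]
  simp only [zf_uu_comp_perm hFsymm huu, Equiv.swap_apply_right]
  congr 1
  simp only [huu]
  rw [integral_const_mul, integral_const_mul]
  congr 1
  have hcomm : ∀ x y : Space, Function.update (Function.update X m y) 0 x =
      Function.update (Function.update X 0 x) m y := fun x y =>
    Function.update_comm hm y x X
  simp only [hcomm]
  exact (zf_integral_update_update_swap L hFt.continuous hC X 0 m).symm

/-! ### The weak commutator identities of `P₀` -/

/-- **KINETIC: `[T, P₀] = 0` in weak form.** For periodic test functions `F` (symmetric) and `b`
with `B = P₀b`: `∫ ∇u₀·∇b = ∫ ∇F·∇(B∘tail)` (both equal `L³ ∫ ∇G·∇B` on the bath). [folklore] -/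
theorem zf_kinetic_uu_zero (hL : 0 < L) {F : Config (n + 2) → ℝ} (hFt : IsPeriodicTest L F)
    {uu : Fin (n + 2) → Config (n + 2) → ℝ}
    (huu : ∀ m X, uu m X = (L ^ 3)⁻¹ * ∫ y in cell L, F (Function.update X m y))
    {G : Config (n + 1) → ℝ} (hG : ∀ Y, G Y = (L ^ 3)⁻¹ * ∫ x in cell L, F (vecCons x Y))
    {b : Config (n + 2) → ℝ} (hb : IsPeriodicTest L b) {B : Config (n + 1) → ℝ}
    (hB : ∀ Y, B Y = (L ^ 3)⁻¹ * ∫ x in cell L, b (vecCons x Y)) :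
    ∫ X in cellN (n + 2) L, gradDot (uu 0) b X =
      ∫ X in cellN (n + 2) L, gradDot F (fun W => B (Fin.tail W)) X := by
  have hGt : IsPeriodicTest L G := zf_isPeriodicTest_G hL hFt hG
  have hBt : IsPeriodicTest L B := zf_avg_isPeriodicTest hL hb hB
  have h0 : uu 0 = fun X => G (Fin.tail X) := funext fun X => zf_uu_zero_eq huu hG X
  rw [h0, zf_integral_gradDot_tail hL hGt.1 hb hB]
  have h1 : ∫ X in cellN (n + 2) L, gradDot F (fun W => B (Fin.tail W)) X =
      ∫ X in cellN (n + 2) L, gradDot (fun W => B (Fin.tail W)) F X :=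
    integral_congr_ae (ae_of_all _ fun X => gradDot_comm _ _ _)
  rw [h1, zf_integral_gradDot_tail hL hBt.1 hFt hG]
  congr 1
  exact integral_congr_ae (ae_of_all _ fun Y => gradDot_comm _ _ _)

/-- **MASS: `P₀ = P₀*` in weak form.** `∫ u₀ b = ∫ F (B∘tail)` for continuous `b` with
`B = P₀b` continuous. [folklore] -/
theorem zf_mass_uu_zero (hL : 0 < L) {F : Config (n + 2) → ℝ} (hFt : IsPeriodicTest L F)
    {uu : Fin (n + 2) → Config (n + 2) → ℝ}
    (huu : ∀ m X, uu m X = (L ^ 3)⁻¹ * ∫ y in cell L, F (Function.update X m y))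
    {G : Config (n + 1) → ℝ} (hG : ∀ Y, G Y = (L ^ 3)⁻¹ * ∫ x in cell L, F (vecCons x Y))
    {b : Config (n + 2) → ℝ} (hb : Continuous b) {B : Config (n + 1) → ℝ} (hBc : Continuous B)
    (hB : ∀ Y, B Y = (L ^ 3)⁻¹ * ∫ x in cell L, b (vecCons x Y)) :
    ∫ X in cellN (n + 2) L, uu 0 X * b X = ∫ X in cellN (n + 2) L, F X * B (Fin.tail X) := by
  have hGc : Continuous G := (zf_isPeriodicTest_G hL hFt hG).continuous
  simp only [zf_uu_zero_eq huu hG]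
  rw [zf_integral_tail_mul hL hGc hb hB]
  have h1 : ∫ X in cellN (n + 2) L, F X * B (Fin.tail X) = ∫ X in cellN (n + 2) L, B (Fin.tail X) * F X :=
    integral_congr_ae (ae_of_all _ fun X => mul_comm _ _)
  rw [h1, zf_integral_tail_mul hL hBc hFt.continuous hG]
  congr 1
  exact integral_congr_ae (ae_of_all _ fun Y => mul_comm _ _)

/-- **POTENTIAL: `[P₀, h∘tail] = 0` in weak form.** For a continuous bath weight `h` (a pair potential
`v^per(x_k − x_l)` with `k, l ≥ 1`, or the whole bath interaction):
`∫ h(tail X) u₀(X) b(X) dX = ∫ h(tail X) F(X) (P₀b)(tail X) dX`. [folklore] -/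
theorem zf_pot_uu_zero (hL : 0 < L) {F : Config (n + 2) → ℝ} (hFt : IsPeriodicTest L F)
    {uu : Fin (n + 2) → Config (n + 2) → ℝ}
    (huu : ∀ m X, uu m X = (L ^ 3)⁻¹ * ∫ y in cell L, F (Function.update X m y))
    {G : Config (n + 1) → ℝ} (hG : ∀ Y, G Y = (L ^ 3)⁻¹ * ∫ x in cell L, F (vecCons x Y))
    {h : Config (n + 1) → ℝ} (hh : Continuous h) {b : Config (n + 2) → ℝ} (hb : Continuous b)
    {B : Config (n + 1) → ℝ} (hBc : Continuous B)
    (hB : ∀ Y, B Y = (L ^ 3)⁻¹ * ∫ x in cell L, b (vecCons x Y)) :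
    ∫ X in cellN (n + 2) L, h (Fin.tail X) * uu 0 X * b X =
      ∫ X in cellN (n + 2) L, h (Fin.tail X) * F X * B (Fin.tail X) := by
  have hGc : Continuous G := (zf_isPeriodicTest_G hL hFt hG).continuous
  simp only [zf_uu_zero_eq huu hG]
  have e1 : ∫ X in cellN (n + 2) L, h (Fin.tail X) * G (Fin.tail X) * b X =
      ∫ X in cellN (n + 2) L, (fun Y => h Y * G Y) (Fin.tail X) * b X := rfl
  have e2 : ∫ X in cellN (n + 2) L, h (Fin.tail X) * F X * B (Fin.tail X) =
      ∫ X in cellN (n + 2) L, (fun Y => h Y * B Y) (Fin.tail X) * F X :=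
    integral_congr_ae (ae_of_all _ fun X => by dsimp only; ring)
  rw [e1, e2, zf_integral_tail_mul hL (a := fun Y => h Y * G Y) (hh.mul hGc) hb hB,
    zf_integral_tail_mul hL (a := fun Y => h Y * B Y) (hh.mul hBc) hFt.continuous hG]
  congr 1
  exact integral_congr_ae (ae_of_all _ fun Y => by dsimp only; ring)

/-! ### Positivity inputs -/

/-- **`‖P₀F‖ ≤ ‖F‖`**: `∫ u₀² ≤ ∫ F²`. [folklore] -/
theorem zf_integral_uu_zero_sq_le (hL : 0 < L) {F : Config (n + 2) → ℝ} (hFt : IsPeriodicTest L F)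
    {uu : Fin (n + 2) → Config (n + 2) → ℝ}
    (huu : ∀ m X, uu m X = (L ^ 3)⁻¹ * ∫ y in cell L, F (Function.update X m y)) :
    ∫ X in cellN (n + 2) L, uu 0 X ^ 2 ≤ ∫ X in cellN (n + 2) L, F X ^ 2 := by
  obtain ⟨G, hG⟩ : ∃ G : Config (n + 1) → ℝ, G = fun Y => (L ^ 3)⁻¹ * ∫ x in cell L, F (vecCons x Y) :=
    ⟨_, rfl⟩
  have hG' : ∀ Y, G Y = (L ^ 3)⁻¹ * ∫ x in cell L, F (vecCons x Y) := fun Y => by rw [hG]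
  have hGc : Continuous G := (zf_isPeriodicTest_G hL hFt hG').continuous
  simp only [zf_uu_zero_eq huu hG']
  exact zf_integral_avg_sq_le hL hFt.continuous hGc hG'

/-- **`P₀ v^per(x₀ − x₁) P₀ = L⁻³‖v‖₁ P₀`**: for a continuous bath function `B`,
`∫ v^per(x₀ − x₁) (B∘tail)² = ‖v‖₁ L⁻³ ∫ (B∘tail)²`. [folklore] -/
theorem zf_integral_pot_tail_sq (hL : 0 < L) {v : ℝ → ℝ≥0∞} (hv : Measurable v) {R₀ : ℝ}
    (hR : ∀ r, R₀ < r → v r = 0) (hfin : ∀ r, v r ≠ ⊤)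
    (hvc : Continuous fun x : Space => (periodizedPotential v L x).toReal)
    {B : Config (n + 1) → ℝ} (hBc : Continuous B) :
    ∫ X in cellN (n + 2) L, (periodizedPotential v L (X 0 - X 1)).toReal * B (Fin.tail X) ^ 2 =
      (∫⁻ y : Space, v ‖y‖).toReal * (L ^ 3)⁻¹ * ∫ X in cellN (n + 2) L, B (Fin.tail X) ^ 2 := by
  have h1 : ∫ X in cellN (n + 2) L, (periodizedPotential v L (X 0 - X 1)).toReal * B (Fin.tail X) ^ 2 =
      (∫⁻ y : Space, v ‖y‖).toReal * ∫ Y in cellN (n + 1) L, B Y ^ 2 :=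
    zf_integral_pot_tail (M := n + 1) hL hv hR hfin hvc (hBc.pow 2) (c := fun Y : Config (n + 1) => Y 0)
      (continuous_apply 0)
  have h2 : ∫ X in cellN (n + 2) L, B (Fin.tail X) ^ 2 = L ^ 3 * ∫ Y in cellN (n + 1) L, B Y * B Y := by
    have h := zf_integral_tail_mul hL hBc (b := fun X => B (Fin.tail X))
      (hBc.comp mixedLaw_continuous_tail) (zf_avg_of_tail hL B)
    simpa only [sq] using h
  rw [h1, h2]
  simp only [sq]
  field_simp

end Summit.AtomisticToContinuum.BoseEinsteinCondensation.Theorems.CorrectorClosure.VolumeHomotopySumRuleDomination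

end
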